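import Summits.QuantumFields.YangMills.Theorems.SandwichVariancePinchingScoreSecondMoment
import Literature.Probability.Distributions.BrascampLiebVarianceInequality

/-!
# Route `SandwichVariancePinching` — crux `QuadraticVarianceCeiling` (stmt-QuantumFields-28259):
# **first-order Brascamp–Lieb for a sandwiched `C²` potential, raw Lebesgue form**

For `A ∈ C²(ℝⁿ)` with the whitened second-difference sandwich (`δ < 1`) the coordinate Hessian is positive
definite with `A_xx ⪰ (1−δ)·1` (`posDef_coordHessian`, from `…ScoreCalculus.le_fderiv_fderiv_of_le_secondDiff`),
hence `vᵀA_xx⁻¹v ≤ (1−δ)⁻¹|v|²` (`inv_quadForm_le`, `blQuad_le_of_sandwich`), and the tree's PROVED Brascamp–Lieb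
inequality `Literature.Probability.Distributions.bl_wholeSpace_raw` (Brascamp–Lieb 1976, Thm 4.1) gives, for every
`C¹` observable `h` of polynomial growth,

  `(∫ h² e^{−A})(∫ e^{−A}) − (∫ h e^{−A})² ≤ (1−δ)⁻¹ (∫ |∇h|² e^{−A}) (∫ e^{−A})`   (`bl_raw_of_sandwich`).

This is the only non-elementary input of the CEILING (Stein proxy route, memo = evidence #4 on 28259): it is
applied to the remainder `R₀ = ∂_{Hx+b}A − q` and to the rows of `H`, never to `q` itself.

HONEST SCOPE.  Free-hands work of the LEAD seat of crux stmt-QuantumFields-22884 (cell ym-idea-1) toward crux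
28259 of planner ym-idea-3's draft-by-design sub-line; nothing here proves the ceiling, `QuadraticCovarianceComparison`
(26240), the `LogConcaveChart` thesis, rung R2a or any summit statement; the Yang–Mills mass gap is NOT proved.
-/

noncomputable section

namespace Summit.QuantumFields.YangMills.Theorems.SandwichVariancePinching

open MeasureTheory Real Filter Topology
open Literature.Probability.Distributions (coordGradient coordHessian bl_wholeSpace_raw continuous_blQuad
  inv_mulVec_dotProduct_mulVec)

variable {n : ℕ}

/-! ## Brascamp–Lieb (first order) for a sandwiched `C²` potential, raw Lebesgue form -/

/-- The coordinate Hessian of a sandwiched `C²` potential is positive definite (`δ < 1`). [folklore] -/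
theorem posDef_coordHessian {A : (Fin n → ℝ) → ℝ} (hA : ContDiff ℝ 2 A) {δ : ℝ} (hδ1 : δ < 1)
    (hsw : ∀ x h : Fin n → ℝ, (1 - δ) * (h ⬝ᵥ h) ≤ A (x + h) + A (x - h) - 2 * A x ∧
      A (x + h) + A (x - h) - 2 * A x ≤ (1 + δ) * (h ⬝ᵥ h)) (x : Fin n → ℝ) :
    (coordHessian A x).PosDef := by
  have hd : DifferentiableAt ℝ (fderiv ℝ A) x :=
    ((hA.fderiv_right (m := 1) (by norm_num)).differentiable (by norm_num)) x
  have hsym : (coordHessian A x).IsHermitian := by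
    rw [Matrix.IsHermitian, Matrix.conjTranspose_eq_transpose_of_trivial]
    ext i j
    rw [Matrix.transpose_apply, Literature.Probability.Moments.coordHessian_apply_eq hd,
      Literature.Probability.Moments.coordHessian_apply_eq hd, fderiv_fderiv_symm hA]
  refine Matrix.PosDef.of_dotProduct_mulVec_pos hsym fun v hv => ?_
  simp only [star_trivial]
  rw [Literature.Probability.Distributions.dotProduct_coordHessian_mulVec hd]
  have h1 := le_fderiv_fderiv_of_le_secondDiff hA (fun y h => (hsw y h).1) x v
  have hvv : 0 < v ⬝ᵥ v := by
    have h0 : 0 ≤ v ⬝ᵥ v := by simpa using dotProduct_self_star_nonneg v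
    rcases h0.lt_or_eq with h | h
    · exact h
    · exfalso; apply hv
      have : v ⬝ᵥ v = 0 := h.symm
      exact dotProduct_self_eq_zero.mp this
  nlinarith

/-- For a positive definite `M ⪰ λ·1` (`λ > 0`): `vᵀ M⁻¹ v ≤ λ⁻¹ |v|²`. [folklore] -/
theorem inv_quadForm_le {M : Matrix (Fin n) (Fin n) ℝ} (hM : M.PosDef) {lam : ℝ} (hlam : 0 < lam)
    (hlow : ∀ w : Fin n → ℝ, lam * (w ⬝ᵥ w) ≤ w ⬝ᵥ M.mulVec w) (v : Fin n → ℝ) :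
    v ⬝ᵥ M⁻¹.mulVec v ≤ lam⁻¹ * (v ⬝ᵥ v) := by
  set w : Fin n → ℝ := M⁻¹.mulVec v with hw
  have h1 : w ⬝ᵥ M.mulVec w = v ⬝ᵥ w := by
    rw [hw]; exact inv_mulVec_dotProduct_mulVec hM v _
  have h2 := hlow w
  -- `X := v·w = vᵀM⁻¹v` satisfies `X = 2X − wᵀMw ≤ 2 v·w − λ|w|² ≤ |v|²/λ`
  have h3 : 0 ≤ lam * ((w - lam⁻¹ • v) ⬝ᵥ (w - lam⁻¹ • v)) :=
    mul_nonneg hlam.le (by simpa using dotProduct_self_star_nonneg (w - lam⁻¹ • v))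
  have e : lam * ((w - lam⁻¹ • v) ⬝ᵥ (w - lam⁻¹ • v)) =
      lam * (w ⬝ᵥ w) - 2 * (v ⬝ᵥ w) + lam⁻¹ * (v ⬝ᵥ v) := by
    simp only [sub_dotProduct, dotProduct_sub, dotProduct_smul, smul_dotProduct, smul_eq_mul,
      dotProduct_comm w v]
    field_simp
    ring
  rw [e] at h3
  have : v ⬝ᵥ M⁻¹.mulVec v = v ⬝ᵥ w := by rw [hw]
  rw [this]
  linarith

/-- The Brascamp–Lieb integrand of a sandwiched potential is dominated by `(1−δ)⁻¹|∇h|²`. [folklore] -/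
theorem blQuad_le_of_sandwich {A : (Fin n → ℝ) → ℝ} (hA : ContDiff ℝ 2 A) {δ : ℝ} (hδ1 : δ < 1)
    (hsw : ∀ x h : Fin n → ℝ, (1 - δ) * (h ⬝ᵥ h) ≤ A (x + h) + A (x - h) - 2 * A x ∧
      A (x + h) + A (x - h) - 2 * A x ≤ (1 + δ) * (h ⬝ᵥ h)) (h : (Fin n → ℝ) → ℝ) (x : Fin n → ℝ) :
    coordGradient h x ⬝ᵥ (coordHessian A x)⁻¹.mulVec (coordGradient h x) ≤
      (1 - δ)⁻¹ * (coordGradient h x ⬝ᵥ coordGradient h x) := by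
  have hd : DifferentiableAt ℝ (fderiv ℝ A) x :=
    ((hA.fderiv_right (m := 1) (by norm_num)).differentiable (by norm_num)) x
  refine inv_quadForm_le (posDef_coordHessian hA hδ1 hsw x) (by linarith) (fun w => ?_) _
  rw [Literature.Probability.Distributions.dotProduct_coordHessian_mulVec hd]
  exact le_fderiv_fderiv_of_le_secondDiff hA (fun y k => (hsw y k).1) x w

/-- **FIRST-ORDER BRASCAMP–LIEB for a sandwiched `C²` potential, raw form**: for `h ∈ C¹` with
`|h| ≲ (1+‖x‖)³` and `|∂ⱼh| ≲ (1+‖x‖)²`,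
`(∫ h²e^{−A})(∫e^{−A}) − (∫ h e^{−A})² ≤ (1−δ)⁻¹ (∫ |∇h|² e^{−A}) (∫ e^{−A})`
— the tree's proved `Literature.Probability.Distributions.bl_wholeSpace_raw` (Brascamp–Lieb 1976,
Thm 4.1) with `A_xx ⪰ (1−δ)·1`. [cite: BrascampLieb1976, Thm 4.1] -/
theorem bl_raw_of_sandwich {A : (Fin n → ℝ) → ℝ} (hA : ContDiff ℝ 2 A) {δ : ℝ} (hδ1 : δ < 1)
    (hsw : ∀ x h : Fin n → ℝ, (1 - δ) * (h ⬝ᵥ h) ≤ A (x + h) + A (x - h) - 2 * A x ∧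
      A (x + h) + A (x - h) - 2 * A x ≤ (1 + δ) * (h ⬝ᵥ h))
    {h : (Fin n → ℝ) → ℝ} (hh : ContDiff ℝ 1 h) {Dh Dh' : ℝ}
    (hhb : ∀ x, |h x| ≤ Dh * (1 + ‖x‖) ^ 3)
    (hh'b : ∀ x (j : Fin n), |fderiv ℝ h x (Pi.single j 1)| ≤ Dh' * (1 + ‖x‖) ^ 2) :
    (∫ x, h x ^ 2 * exp (-A x)) * (∫ x, exp (-A x)) - (∫ x, h x * exp (-A x)) ^ 2 ≤
      (1 - δ)⁻¹ * (∫ x, (coordGradient h x ⬝ᵥ coordGradient h x) * exp (-A x)) * (∫ x, exp (-A x)) := by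
  have hAc : Continuous A := hA.continuous
  obtain ⟨C₀, κ, _, hκ, hlb⟩ := exists_quadratic_lower_of_sandwich hAc hδ1 hsw
  have hpd := posDef_coordHessian hA hδ1 hsw
  have hZ : Integrable fun x => exp (-A x) := by
    have := integrable_mul_exp_neg_of_growth hAc continuous_const hκ (by norm_num : 0 ≤ 8) hlb
      (w := fun _ => (1:ℝ)) (D := 1) (fun x => by simp)
    simpa using this
  have hI1 : Integrable fun x => h x * exp (-A x) :=
    integrable_mul_exp_neg_of_growth hAc hh.continuous hκ (by norm_num) hlb hhb
  have hI2 : Integrable fun x => h x ^ 2 * exp (-A x) := by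
    have := abs_mul_le_growth hhb hhb
    refine integrable_mul_exp_neg_of_growth hAc (hh.continuous.pow 2) hκ (by norm_num : 3 + 3 ≤ 8) hlb
      (D := Dh * Dh) (fun x => ?_)
    rw [sq]; exact this x
  -- the squared gradient and its growth
  have hgb : ∀ x, |coordGradient h x ⬝ᵥ coordGradient h x| ≤ (n : ℝ) * Dh' ^ 2 * (1 + ‖x‖) ^ 4 := by
    intro x
    have h0 : 0 ≤ coordGradient h x ⬝ᵥ coordGradient h x := by
      simpa using dotProduct_self_star_nonneg (coordGradient h x)
    rw [abs_of_nonneg h0]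
    simp only [dotProduct, coordGradient]
    calc ∑ j, fderiv ℝ h x (Pi.single j 1) * fderiv ℝ h x (Pi.single j 1)
        ≤ ∑ _j : Fin n, Dh' ^ 2 * (1 + ‖x‖) ^ 4 := Finset.sum_le_sum fun j _ => by
          have h1 := hh'b x j
          have h2 : |fderiv ℝ h x (Pi.single j 1)| ^ 2 ≤ (Dh' * (1 + ‖x‖) ^ 2) ^ 2 :=
            pow_le_pow_left₀ (abs_nonneg _) h1 2
          rw [sq_abs] at h2
          nlinarith [h2]
      _ = (n : ℝ) * Dh' ^ 2 * (1 + ‖x‖) ^ 4 := by simp [Finset.sum_const]; ring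
  have hgc : Continuous fun x => coordGradient h x ⬝ᵥ coordGradient h x :=
    (Literature.Probability.Distributions.continuous_coordGradient hh).dotProduct
      (Literature.Probability.Distributions.continuous_coordGradient hh)
  have hIg : Integrable fun x => (coordGradient h x ⬝ᵥ coordGradient h x) * exp (-A x) :=
    integrable_mul_exp_neg_of_growth hAc hgc hκ (by norm_num) hlb hgb
  -- the BL integrand is dominated by `(1−δ)⁻¹ |∇h|²`
  have hQc := continuous_blQuad hA hpd hh
  have hQ0 := fun x => Literature.Probability.Distributions.blQuad_nonneg (h := h) hpd x
  have hQle : ∀ x, coordGradient h x ⬝ᵥ (coordHessian A x)⁻¹.mulVec (coordGradient h x) * exp (-A x) ≤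
      (1 - δ)⁻¹ * ((coordGradient h x ⬝ᵥ coordGradient h x) * exp (-A x)) := fun x => by
    have := blQuad_le_of_sandwich hA hδ1 hsw h x
    have he := (exp_pos (-A x)).le
    nlinarith
  have hIQ : Integrable fun x => coordGradient h x ⬝ᵥ (coordHessian A x)⁻¹.mulVec (coordGradient h x) * exp (-A x) := by
    refine (hIg.const_mul ((1 - δ)⁻¹)).mono' ((hQc.mul (continuous_exp.comp hAc.neg)).aestronglyMeasurable)
      (ae_of_all _ fun x => ?_)
    rw [Real.norm_eq_abs, abs_of_nonneg (mul_nonneg (hQ0 x) (exp_pos _).le)]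
    exact hQle x
  have hraw := bl_wholeSpace_raw hA hpd hh hZ hI1 hI2 hIQ
  have hmono : ∫ x, coordGradient h x ⬝ᵥ (coordHessian A x)⁻¹.mulVec (coordGradient h x) * exp (-A x) ≤
      (1 - δ)⁻¹ * ∫ x, (coordGradient h x ⬝ᵥ coordGradient h x) * exp (-A x) := by
    rw [← integral_const_mul]
    exact integral_mono hIQ (hIg.const_mul _) hQle
  have hZ0 : 0 ≤ ∫ x, exp (-A x) := integral_nonneg fun x => (exp_pos _).le
  exact hraw.trans (mul_le_mul_of_nonneg_right hmono hZ0)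

end Summit.QuantumFields.YangMills.Theorems.SandwichVariancePinching

end
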